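import Literature.Geometry.Lorentzian.StationaryMetricDecomposition
import Literature.Geometry.Lorentzian.StationaryOrbitQuotientMetric
import HarnessLib

/-!
# The 1-form `ϑ = A − dt` descends to the orbit space: `ϑ = π^* ϑ_S`
(Anderson 2000, §0, (0.1): the connection 1-form `θ` of `g_M = -u²(dt + θ)² + π^* g_S` lives on `S`)

For a bundled four-dimensional chronological stationary spacetime with stationary Killing field
`X`, flow `θₛ = hX.flow`, a time function `t` and the 1-form `ϑ = A − dt` on `M`
(`StationaryMetricDecomposition.lean`: `ϑ(X) = 0`, `θₛ^* ϑ = ϑ`), this file constructs the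
1-form `ϑ_S` on the orbit 3-manifold `S` of which `ϑ` is the pull-back, pointwise:

* `Spacetime.IsStationaryKilling.horizontalLiftCLM` — the horizontal lift `H_y : ℝ³ →L T_y M` as a
  continuous linear map (`horizontalLift` is linear);
* `Spacetime.IsStationaryKilling.thetaForm_apply_eq_horizontalLift` — **`ϑ` only sees the
  horizontal part**: `ϑ_y(v) = ϑ_y(H_y(dπ v))` (`v − H(dπ v) ∈ ker dπ = ℝ·X` and `ϑ(X) = 0`);
* `Spacetime.IsStationaryKilling.thetaFormS hX hchr t z` — **the 1-form `ϑ_S` on `S`**: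
  `ϑ_S(z)(ζ) = ϑ_y(H_y ζ)` at the representative `y = z.out`; `thetaFormS_orbitProj` — the same
  value at **every** event `y` over `z` (flow invariance of `ϑ` and flow equivariance of `H`);
* `Spacetime.IsStationaryKilling.thetaForm_eq_thetaFormS` — **`ϑ = π^* ϑ_S`**:
  `ϑ_y(v) = ϑ_S(π y)(dπ_y v)` for all `v`;
* `Spacetime.IsStationaryKilling.val_eq_anderson_S` — hence Anderson's (0.1) with all data on
  `S`: `g(v, w) = -u²(π y) (dt v + ϑ_S(dπ v)) (dt w + ϑ_S(dπ w)) + g_S(π y)(dπ v, dπ w)`.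

Not here: smoothness of `z ↦ ϑ_S(z)` as a section of the cotangent bundle of `S`. No named facts.

## References

* M. T. Anderson, Ann. Henri Poincaré 1 (2000) 977–994, arXiv:gr-qc/0001091, §0, (0.1)–(0.2)
  (key `Anderson2000`).
-/

noncomputable section

open Bundle Set Filter Function Manifold TopologicalSpace
open scoped ContDiff Topology Manifold

namespace Literature.Geometry.Lorentzian

namespace Spacetime

universe u

variable {𝓢 : Spacetime.{u} 4} [𝓢.metric.HasLeviCivita]
  {X : Π x : 𝓢.carrier, TangentSpace (𝓡 4) x}

/-! ### The horizontal lift as a continuous linear map -/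

/-- The horizontal lift `H_y : ℝ³ → T_y M` as a continuous linear map (`horizontalLift_add`,
`horizontalLift_smul`; finite dimension). [cite: Anderson2000, §1.1] -/
def IsStationaryKilling.horizontalLiftCLM (hX : 𝓢.IsStationaryKilling X univ)
    (hchr : 𝓢.metric.IsChronological 𝓢.timeOrientation) (y : 𝓢.carrier) :
    EuclideanSpace ℝ (Fin 3) →L[ℝ] TangentSpace (𝓡 4) y :=
  LinearMap.toContinuousLinearMap
    { toFun := hX.horizontalLift hchr y
      map_add' := hX.horizontalLift_add hchr y
      map_smul' := hX.horizontalLift_smul hchr y }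

/-- Unfolding lemma. [folklore] -/
@[simp]
theorem IsStationaryKilling.horizontalLiftCLM_apply (hX : 𝓢.IsStationaryKilling X univ)
    (hchr : 𝓢.metric.IsChronological 𝓢.timeOrientation) (y : 𝓢.carrier)
    (ζ : EuclideanSpace ℝ (Fin 3)) :
    hX.horizontalLiftCLM hchr y ζ = hX.horizontalLift hchr y ζ := rfl

/-! ### `ϑ` only sees the horizontal part -/

/-- **`ϑ` factors through `dπ`**: `ϑ_y(v) = ϑ_y(H_y(dπ_y v))` — the difference `v − H(dπ v)` lies
in `ker dπ_y = ℝ·X y` (`ker_mfderiv_orbitProj_eq_span`) and `ϑ(X) = 0` (`thetaForm_apply_self`).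
[cite: Anderson2000, §0, (0.1)] -/
theorem IsStationaryKilling.thetaForm_apply_eq_horizontalLift (hX : 𝓢.IsStationaryKilling X univ)
    (hchr : 𝓢.metric.IsChronological 𝓢.timeOrientation) {t : 𝓢.carrier → ℝ}
    (ht : ContMDiff (𝓡 4) 𝓘(ℝ, ℝ) ∞ t) (htθ : ∀ s y, t (hX.flow (s, y)) = t y + s)
    (y : 𝓢.carrier) (v : TangentSpace (𝓡 4) y) :
    letI := hX.orbitSpaceChartedSpace hchr
    hX.thetaForm t y v =
      hX.thetaForm t y (hX.horizontalLift hchr y (mfderiv (𝓡 4) (𝓡 3) (orbitProj X) y v)) := by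
  letI := hX.orbitSpaceChartedSpace hchr
  -- `v - H(dπ v) ∈ ker dπ = ℝ·X`
  set w := hX.horizontalLift hchr y (mfderiv (𝓡 4) (𝓡 3) (orbitProj X) y v) with hw
  have hker : v - w ∈ LinearMap.ker (mfderiv (𝓡 4) (𝓡 3) (orbitProj X) y).toLinearMap := by
    rw [LinearMap.mem_ker]
    change mfderiv (𝓡 4) (𝓡 3) (orbitProj X) y (v - w) = 0
    rw [map_sub, hw, hX.mfderiv_orbitProj_horizontalLift hchr, sub_self]
  rw [hX.ker_mfderiv_orbitProj_eq_span hchr y, Submodule.mem_span_singleton] at hker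
  obtain ⟨c, hc⟩ := hker
  have hv : v = w + c • X y := by rw [hc, add_sub_cancel]
  conv_lhs => rw [hv]
  rw [map_add, map_smul, hX.thetaForm_apply_self hX.isMIntegralCurve_flow hX.flow_zero ht htθ y,
    smul_zero, add_zero]

/-! ### The 1-form `ϑ_S` on the orbit space -/

/-- **The 1-form `ϑ_S` on the orbit space** (Anderson's connection form `θ` of (0.1), as a form on
`S`): `ϑ_S(z)(ζ) = ϑ_y(H_y ζ)` at the representative event `y = z.out`; by `thetaFormS_orbitProj`
any event over `z` gives the same value. [cite: Anderson2000, §0, (0.1)] -/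
def IsStationaryKilling.thetaFormS (hX : 𝓢.IsStationaryKilling X univ)
    (hchr : 𝓢.metric.IsChronological 𝓢.timeOrientation) (t : 𝓢.carrier → ℝ)
    (z : OrbitSpace X) : EuclideanSpace ℝ (Fin 3) →L[ℝ] ℝ :=
  (hX.thetaForm t z.out).comp (hX.horizontalLiftCLM hchr z.out)

/-- **`ϑ_S` may be computed at any event of the orbit**: `ϑ_S(π y)(ζ) = ϑ_y(H_y ζ)` — the
representative `z.out = θₛ y` for some `s`, `H_{θₛ y} = dθₛ ∘ H_y` (`horizontalLift_flow`) and
`θₛ^* ϑ = ϑ` (`thetaForm_flow`). [cite: Anderson2000, §0, (0.1)] -/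
theorem IsStationaryKilling.thetaFormS_orbitProj (hX : 𝓢.IsStationaryKilling X univ)
    (hchr : 𝓢.metric.IsChronological 𝓢.timeOrientation) {t : 𝓢.carrier → ℝ}
    (ht : ContMDiff (𝓡 4) 𝓘(ℝ, ℝ) ∞ t) (htθ : ∀ s y, t (hX.flow (s, y)) = t y + s)
    (y : 𝓢.carrier) (ζ : EuclideanSpace ℝ (Fin 3)) :
    hX.thetaFormS hchr t (orbitProj X y) ζ = hX.thetaForm t y (hX.horizontalLift hchr y ζ) := by
  -- `(π y).out = θ(s, y)` for some `s`
  have hX1 := hX.contMDiff_one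
  have hc : IsCompleteVectorField X := fun x ↦
    ⟨fun s ↦ hX.flow (s, x), hX.isMIntegralCurve_flow x, hX.flow_zero x⟩
  have hmem : (orbitProj X y).out ∈ Literature.Geometry.Lorentzian.stationaryOrbit X {y} := by
    rw [← orbitProj_eq_iff X hX1 hc]
    exact (Quotient.out_eq _).symm
  obtain ⟨s, hs⟩ := (mem_stationaryOrbit_singleton_iff_exists_flow_eq hX1
    hX.isMIntegralCurve_flow hX.flow_zero).1 hmem
  have key : hX.thetaForm t (hX.flow (s, y)) (hX.horizontalLift hchr (hX.flow (s, y)) ζ) =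
      hX.thetaForm t y (hX.horizontalLift hchr y ζ) := by
    rw [hX.horizontalLift_flow hchr s y ζ]
    exact hX.thetaForm_flow (hX.contMDiff_flow.of_le (WithTop.coe_le_coe.mpr le_top))
      hX.flow_zero hX.flow_add hX.isMIntegralCurve_flow ht htθ s y _
  rw [hs] at key
  exact key

/-- **`ϑ = π^* ϑ_S`**: `ϑ_y(v) = ϑ_S(π y)(dπ_y v)` for every tangent vector `v` of `M` — the
horizontal, invariant 1-form `ϑ` is the pull-back of the 1-form `ϑ_S` on the orbit space
(Anderson 2000, (0.1): the connection form lives on `S`). [cite: Anderson2000, §0, (0.1)] -/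
theorem IsStationaryKilling.thetaForm_eq_thetaFormS (hX : 𝓢.IsStationaryKilling X univ)
    (hchr : 𝓢.metric.IsChronological 𝓢.timeOrientation) {t : 𝓢.carrier → ℝ}
    (ht : ContMDiff (𝓡 4) 𝓘(ℝ, ℝ) ∞ t) (htθ : ∀ s y, t (hX.flow (s, y)) = t y + s)
    (y : 𝓢.carrier) (v : TangentSpace (𝓡 4) y) :
    letI := hX.orbitSpaceChartedSpace hchr
    hX.thetaForm t y v =
      hX.thetaFormS hchr t (orbitProj X y) (mfderiv (𝓡 4) (𝓡 3) (orbitProj X) y v) := by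
  letI := hX.orbitSpaceChartedSpace hchr
  rw [hX.thetaFormS_orbitProj hchr ht htθ]
  exact hX.thetaForm_apply_eq_horizontalLift hchr ht htθ y v

/-- **Anderson 2000, (0.1)–(0.2), with all data on `S`.** For a chronological stationary
spacetime, a time function `t` and tangent vectors `v, w` at an event `y` over `z = π y`:
`g(v, w) = -u²(z) (dt v + ϑ_S(z)(dπ v)) (dt w + ϑ_S(z)(dπ w)) + g_S(z)(dπ v, dπ w)`, where
`u² = lapse²` would be `-⟨X, X⟩` (written here as `-⟨X, X⟩_y`), `ϑ_S` is the connection form on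
`S` and `g_S` the quotient metric (`quotientMetricVal_mfderiv_orbitProj`). [cite: Anderson2000, §0, (0.1)–(0.2)] -/
theorem IsStationaryKilling.val_eq_anderson_S (hX : 𝓢.IsStationaryKilling X univ)
    (hchr : 𝓢.metric.IsChronological 𝓢.timeOrientation) {t : 𝓢.carrier → ℝ}
    (ht : ContMDiff (𝓡 4) 𝓘(ℝ, ℝ) ∞ t) (htθ : ∀ s y, t (hX.flow (s, y)) = t y + s)
    (y : 𝓢.carrier) (v w : TangentSpace (𝓡 4) y) :
    letI := hX.orbitSpaceChartedSpace hchr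
    𝓢.metric.val y v w =
      -(-𝓢.metric.val y (X y) (X y)) *
          (mvfderiv (𝓡 4) t y v +
            hX.thetaFormS hchr t (orbitProj X y) (mfderiv (𝓡 4) (𝓡 3) (orbitProj X) y v)) *
          (mvfderiv (𝓡 4) t y w +
            hX.thetaFormS hchr t (orbitProj X y) (mfderiv (𝓡 4) (𝓡 3) (orbitProj X) y w)) +
        hX.quotientMetricVal hchr (orbitProj X y) (mfderiv (𝓡 4) (𝓡 3) (orbitProj X) y v)
          (mfderiv (𝓡 4) (𝓡 3) (orbitProj X) y w) := by
  letI := hX.orbitSpaceChartedSpace hchr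
  rw [← hX.thetaForm_eq_thetaFormS hchr ht htθ y v, ← hX.thetaForm_eq_thetaFormS hchr ht htθ y w,
    hX.quotientMetricVal_mfderiv_orbitProj hchr y v w]
  exact hX.val_eq_anderson t y v w

end Spacetime

end Literature.Geometry.Lorentzian

end
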